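import Mathlib
import Summits.ValiantsHypothesis.ValiantsHypothesis.Theorems.GeneratorObstructionsPerGenDegreeSuperQPPaddedTableauCounts
import Literature.Computability.AlgebraicComplexity.TableauScaling

/-!
# Route GeneratorObstructions — crux K1 `PerGenDegreeSuperQP` (stmt-ValiantsHypothesis-11654), line
# `per-side-atoms`: the padded gadget tableau datum is framed (its box map is a bijection)

Companion of `…PerGenDegreeSuperQPPaddedTableauDefs` (`paddedTab`, `padBox`, `padBox_lt`) and
`…PaddedTableauCounts` (`card_boxes_paddedTab`).  Here: `padBox` is injective on `[0,d) × [0,m)`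
(gadget boxes: `boxColRow_injective 1 (c+1)` of the crux-K2 gadget tableau plus injectivity of the row
shift `padRow` on the rows that occur — rows `≤ 3c` other than `3c - 1`, `boxColRow_snd_ne`; `z`-boxes:
the four `z`-slot regimes and the singleton pool occupy disjoint column ranges and are injective inside
each, `zSlotCol_spec` / `zSlotCol_inj` / `zSlotCol_range`), the diagram has `d · m` boxes, hence the box map
is a bijection (`paddedTab_box_bijective`) and `paddedTabFrame` is a `TabM.Frame` — the input format of
`TableauEval.TabM.tabPoly_mem_highestWeightSpace` / `exists_hwv_evalAtPoint_ne_zero_of_tabPoly`.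
Blueprint: evidence memo `evidence-11654-leafhand3-g7.md` on the item (plan step L2).

Honest framing: index arithmetic; no stub, crux or summit is settled here; `VP ≠ VNP` untouched.
[folklore]
-/

namespace Summit.ValiantsHypothesis.ValiantsHypothesis.Theorems.GeneratorObstructions.PerGenDegreeSuperQP

open Literature.Computability.AlgebraicComplexity Literature.Computability.AlgebraicComplexity.TableauEval
open Summit.ValiantsHypothesis.ValiantsHypothesis.Theorems.GeneratorObstructions.PowGenDegreeQP

-- `Summit.ValiantsHypothesis.ValiantsHypothesis.…` is the tree's mandated single-conjunct layout.
set_option linter.dupNamespace false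

noncomputable section

/-! ## Injectivity of the box map -/

/-- Rows of blocks `≥ 1` of the `(c+1)`-block scheme avoid row `3c - 1` (the deleted `A'_0`). [folklore] -/
theorem letterRow_succ_ne {c J : ℕ} (hc : 1 ≤ c) (hJ : 1 ≤ J) (hJc : J < c + 1) (κ : Fin 3) :
    letterRow (c + 1) J κ ≠ 3 * c - 1 := by
  have h1 := le_letterPos (c + 1) J κ
  have h2 : letterPos (c + 1) J κ ≠ 3 := by
    by_cases hJ2 : 2 ≤ J
    · omega
    · intro h3
      have h00 : letterPos (c + 1) 0 0 = 3 := by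
        rw [letterPos_zero, if_neg (by omega)]
      have := (letterPos_inj (c := c + 1) hJc (by omega) (h3.trans h00.symm)).1
      omega
  unfold letterRow; omega

/-- Blocks of the labels `u + 3 < 3(2^{c+1}-1)` are `< c + 1`. [folklore] -/
theorem labBlock_add_three_lt {c u : ℕ} (hu : u + 3 < 3 * (2 ^ (c + 1) - 1)) :
    1 ≤ labBlock (u + 3) ∧ labBlock (u + 3) < c + 1 := by
  have h := (labBlock_lt (c := c + 1) ⟨u + 3, hu⟩).1
  refine ⟨?_, h⟩
  unfold labBlock
  have : 2 ≤ (u + 3) / 3 + 1 := by omega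
  calc 1 = Nat.log 2 2 := by norm_num
    _ ≤ Nat.log 2 ((u + 3) / 3 + 1) := Nat.log_mono_right this

/-- The gadget rows of labels `≥ 3` of `gadgetTab 1 (c+1)` avoid row `3c - 1`. [folklore] -/
theorem boxColRow_snd_ne {c : ℕ} (hc : 1 ≤ c) (u s : ℕ) (hu : u + 3 < 3 * (2 ^ (c + 1) - 1)) :
    (boxColRow 1 (c + 1) (u + 3) s).2 ≠ 3 * c - 1 := by
  obtain ⟨hj, hjc⟩ := labBlock_add_three_lt hu
  unfold boxColRow
  split_ifs <;> exact letterRow_succ_ne hc hj hjc _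

/-- `topPow v` brackets `v + 2`: `topPow v ≤ v + 2 < 2 · topPow v`, and `2 ≤ topPow v`. [folklore] -/
theorem topPow_bracket (v : ℕ) : topPow v ≤ v + 2 ∧ v + 2 < 2 * topPow v ∧ 2 ≤ topPow v := by
  refine ⟨topPow_le v, ?_, ?_⟩
  · unfold topPow
    have := Nat.lt_pow_succ_log_self (b := 2) (by norm_num) (v + 2)
    rw [pow_succ] at this; omega
  · unfold topPow
    calc 2 = 2 ^ 1 := by norm_num
      _ ≤ 2 ^ Nat.log 2 (v + 2) := Nat.pow_le_pow_right (by norm_num)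
          (by calc 1 = Nat.log 2 2 := by norm_num
                _ ≤ Nat.log 2 (v + 2) := Nat.log_mono_right (by omega))

/-- Two powers of two are equal or differ by a factor `≥ 2`. [folklore] -/
theorem topPow_dichotomy (v v' : ℕ) :
    topPow v = topPow v' ∨ 2 * topPow v ≤ topPow v' ∨ 2 * topPow v' ≤ topPow v := by
  unfold topPow
  set L := Nat.log 2 (v + 2)
  set L' := Nat.log 2 (v' + 2)
  rcases lt_trichotomy L L' with h | h | h
  · right; left
    calc 2 * 2 ^ L = 2 ^ (L + 1) := by rw [pow_succ]; ring
      _ ≤ 2 ^ L' := Nat.pow_le_pow_right (by norm_num) h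
  · left; rw [h]
  · right; right
    calc 2 * 2 ^ L' = 2 ^ (L' + 1) := by rw [pow_succ]; ring
      _ ≤ 2 ^ L := Nat.pow_le_pow_right (by norm_num) h

/-- Case description of the `z`-slot columns. [folklore] -/
theorem zSlotCol_spec (c u i : ℕ) :
    (i = 0 ∧ u < padD1 c ∧ zSlotCol c u i = 3 * (u / 3 + 2 + topPow (u / 3)) + u % 3) ∨
    (i = 1 ∧ u < padD1 c ∧ zSlotCol c u i = 3 * (u / 3 + 2 + 2 * topPow (u / 3)) + u % 3) ∨
    (i = 2 ∧ u < 6 ∧ zSlotCol c u i = 3 * (1 - u / 3) + u % 3) ∨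
    (i = 3 ∧ u < 6 ∧ zSlotCol c u i = 3 * (2 + u / 3) + (2 - u % 3)) ∨
    (¬ (i = 0 ∧ u < padD1 c) ∧ ¬ (i = 1 ∧ u < padD1 c) ∧ ¬ (i = 2 ∧ u < 6) ∧ ¬ (i = 3 ∧ u < 6) ∧
      ((u < padD1 c ∧ zSlotCol c u i = padTall c + padD c * padE4 c + (2 * (u - 6) + (i - 2))) ∨
       (padD1 c ≤ u ∧ zSlotCol c u i =
          padTall c + padD c * padE4 c + (2 * (padD1 c - 6) + 4 * (u - padD1 c) + i)))) := by
  unfold zSlotCol dedIdx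
  split_ifs with h0 h1 h2 h3 h5
  · exact Or.inl ⟨h0.1, h0.2, rfl⟩
  · exact Or.inr (Or.inl ⟨h1.1, h1.2, rfl⟩)
  · exact Or.inr (Or.inr (Or.inl ⟨h2.1, h2.2, rfl⟩))
  · exact Or.inr (Or.inr (Or.inr (Or.inl ⟨h3.1, h3.2, rfl⟩)))
  · exact Or.inr (Or.inr (Or.inr (Or.inr ⟨h0, h1, h2, h3, Or.inl ⟨h5, rfl⟩⟩)))
  · exact Or.inr (Or.inr (Or.inr (Or.inr ⟨h0, h1, h2, h3, Or.inr ⟨Nat.not_lt.mp h5, rfl⟩⟩)))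

/-- Injectivity of the `z`-slot columns, case 1. [folklore] -/
theorem zSlotCol_inj_aux1 {c : ℕ} (hc : 2 ≤ c) {u u' i i' : ℕ} (_hu : u < padD c) (_hu' : u' < padD c)
    (_hi : i < 4) (hi' : i' < 4) (hi0 : i = 0) (hu0 : u < padD1 c)
    (h : 3 * (u / 3 + 2 + topPow (u / 3)) + u % 3 = zSlotCol c u' i') : u = u' ∧ i = i' := by
  obtain ⟨h4, hD, hT, hD1, hDed, hE4⟩ := pad_sizes hc
  obtain ⟨hP1, hP2, hP3⟩ := topPow_bracket (u / 3)
  obtain ⟨hP1', hP2', hP3'⟩ := topPow_bracket (u' / 3)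
  have hdich := topPow_dichotomy (u / 3) (u' / 3)
  have hPc : u < padD1 c → 2 * topPow (u / 3) ≤ 2 ^ c := fun h1 =>
    two_mul_topPow_le (by rw [hD1] at h1; omega)
  have hPc' : u' < padD1 c → 2 * topPow (u' / 3) ≤ 2 ^ c := fun h1 =>
    two_mul_topPow_le (by rw [hD1] at h1; omega)
  set P := topPow (u / 3)
  set P' := topPow (u' / 3)
  rcases zSlotCol_spec c u' i' with ⟨hi0', hu0', e0'⟩ | ⟨hi0', hu0', e0'⟩ | ⟨hi0', hu0', e0'⟩ |
      ⟨hi0', hu0', e0'⟩ | ⟨n0', n1', n2', n3', ⟨hu0', e0'⟩ | ⟨hu0', e0'⟩⟩ <;>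
  rw [e0'] at h
  all_goals try have hA' : 2 * P' ≤ 2 ^ c := hPc' ‹u' < padD1 c›
  all_goals try have hA : 2 * P ≤ 2 ^ c := hPc ‹u < padD1 c›
  all_goals clear hPc hPc' e0'
  all_goals try simp only [not_and, not_lt] at n0' n1' n2' n3'
  all_goals omega

/-- Injectivity of the `z`-slot columns, case 2. [folklore] -/
theorem zSlotCol_inj_aux2 {c : ℕ} (hc : 2 ≤ c) {u u' i i' : ℕ} (_hu : u < padD c) (_hu' : u' < padD c)
    (_hi : i < 4) (hi' : i' < 4) (hi0 : i = 1) (hu0 : u < padD1 c)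
    (h : 3 * (u / 3 + 2 + 2 * topPow (u / 3)) + u % 3 = zSlotCol c u' i') : u = u' ∧ i = i' := by
  obtain ⟨h4, hD, hT, hD1, hDed, hE4⟩ := pad_sizes hc
  obtain ⟨hP1, hP2, hP3⟩ := topPow_bracket (u / 3)
  obtain ⟨hP1', hP2', hP3'⟩ := topPow_bracket (u' / 3)
  have hdich := topPow_dichotomy (u / 3) (u' / 3)
  have hPc : u < padD1 c → 2 * topPow (u / 3) ≤ 2 ^ c := fun h1 =>
    two_mul_topPow_le (by rw [hD1] at h1; omega)
  have hPc' : u' < padD1 c → 2 * topPow (u' / 3) ≤ 2 ^ c := fun h1 =>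
    two_mul_topPow_le (by rw [hD1] at h1; omega)
  set P := topPow (u / 3)
  set P' := topPow (u' / 3)
  rcases zSlotCol_spec c u' i' with ⟨hi0', hu0', e0'⟩ | ⟨hi0', hu0', e0'⟩ | ⟨hi0', hu0', e0'⟩ |
      ⟨hi0', hu0', e0'⟩ | ⟨n0', n1', n2', n3', ⟨hu0', e0'⟩ | ⟨hu0', e0'⟩⟩ <;>
  rw [e0'] at h
  all_goals try have hA' : 2 * P' ≤ 2 ^ c := hPc' ‹u' < padD1 c›
  all_goals try have hA : 2 * P ≤ 2 ^ c := hPc ‹u < padD1 c›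
  all_goals clear hPc hPc' e0'
  all_goals try simp only [not_and, not_lt] at n0' n1' n2' n3'
  all_goals omega

/-- Injectivity of the `z`-slot columns, case 3. [folklore] -/
theorem zSlotCol_inj_aux3 {c : ℕ} (hc : 2 ≤ c) {u u' i i' : ℕ} (hu : u < padD c) (hu' : u' < padD c)
    (_hi : i < 4) (hi' : i' < 4) (hi0 : i = 2) (hu0 : u < 6)
    (h : 3 * (1 - u / 3) + u % 3 = zSlotCol c u' i') : u = u' ∧ i = i' := by
  obtain ⟨h4, hD, hT, hD1, hDed, hE4⟩ := pad_sizes hc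
  obtain ⟨hP1, hP2, hP3⟩ := topPow_bracket (u / 3)
  obtain ⟨hP1', hP2', hP3'⟩ := topPow_bracket (u' / 3)
  have hdich := topPow_dichotomy (u / 3) (u' / 3)
  have hPc : u < padD1 c → 2 * topPow (u / 3) ≤ 2 ^ c := fun h1 =>
    two_mul_topPow_le (by rw [hD1] at h1; omega)
  have hPc' : u' < padD1 c → 2 * topPow (u' / 3) ≤ 2 ^ c := fun h1 =>
    two_mul_topPow_le (by rw [hD1] at h1; omega)
  set P := topPow (u / 3)
  set P' := topPow (u' / 3)
  rcases zSlotCol_spec c u' i' with ⟨hi0', hu0', e0'⟩ | ⟨hi0', hu0', e0'⟩ | ⟨hi0', hu0', e0'⟩ |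
      ⟨hi0', hu0', e0'⟩ | ⟨n0', n1', n2', n3', ⟨hu0', e0'⟩ | ⟨hu0', e0'⟩⟩ <;>
  rw [e0'] at h
  all_goals try have hA' : 2 * P' ≤ 2 ^ c := hPc' ‹u' < padD1 c›
  all_goals clear hPc hPc' e0'
  all_goals try simp only [not_and, not_lt] at n0' n1' n2' n3'
  all_goals omega

/-- Injectivity of the `z`-slot columns, case 4. [folklore] -/
theorem zSlotCol_inj_aux4 {c : ℕ} (hc : 2 ≤ c) {u u' i i' : ℕ} (hu : u < padD c) (hu' : u' < padD c)
    (_hi : i < 4) (hi' : i' < 4) (hi0 : i = 3) (hu0 : u < 6)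
    (h : 3 * (2 + u / 3) + (2 - u % 3) = zSlotCol c u' i') : u = u' ∧ i = i' := by
  obtain ⟨h4, hD, hT, hD1, hDed, hE4⟩ := pad_sizes hc
  obtain ⟨hP1, hP2, hP3⟩ := topPow_bracket (u / 3)
  obtain ⟨hP1', hP2', hP3'⟩ := topPow_bracket (u' / 3)
  have hdich := topPow_dichotomy (u / 3) (u' / 3)
  have hPc : u < padD1 c → 2 * topPow (u / 3) ≤ 2 ^ c := fun h1 =>
    two_mul_topPow_le (by rw [hD1] at h1; omega)
  have hPc' : u' < padD1 c → 2 * topPow (u' / 3) ≤ 2 ^ c := fun h1 =>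
    two_mul_topPow_le (by rw [hD1] at h1; omega)
  set P := topPow (u / 3)
  set P' := topPow (u' / 3)
  rcases zSlotCol_spec c u' i' with ⟨hi0', hu0', e0'⟩ | ⟨hi0', hu0', e0'⟩ | ⟨hi0', hu0', e0'⟩ |
      ⟨hi0', hu0', e0'⟩ | ⟨n0', n1', n2', n3', ⟨hu0', e0'⟩ | ⟨hu0', e0'⟩⟩ <;>
  rw [e0'] at h
  all_goals try have hA' : 2 * P' ≤ 2 ^ c := hPc' ‹u' < padD1 c›
  all_goals clear hPc hPc' e0'
  all_goals try simp only [not_and, not_lt] at n0' n1' n2' n3'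
  all_goals omega

/-- Injectivity of the `z`-slot columns, case 5. [folklore] -/
theorem zSlotCol_inj_aux5 {c : ℕ} (hc : 2 ≤ c) {u u' i i' : ℕ} (hu : u < padD c) (hu' : u' < padD c)
    (hi : i < 4) (hi' : i' < 4) (n0 : i = 0 → padD1 c ≤ u) (n1 : i = 1 → padD1 c ≤ u) (n2 : i = 2 → 6 ≤ u) (n3 : i = 3 → 6 ≤ u) (hu0 : u < padD1 c)
    (h : padTall c + padD c * padE4 c + (2 * (u - 6) + (i - 2)) = zSlotCol c u' i') : u = u' ∧ i = i' := by
  obtain ⟨h4, hD, hT, hD1, hDed, hE4⟩ := pad_sizes hc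
  obtain ⟨hP1, hP2, hP3⟩ := topPow_bracket (u / 3)
  obtain ⟨hP1', hP2', hP3'⟩ := topPow_bracket (u' / 3)
  have hdich := topPow_dichotomy (u / 3) (u' / 3)
  have hPc : u < padD1 c → 2 * topPow (u / 3) ≤ 2 ^ c := fun h1 =>
    two_mul_topPow_le (by rw [hD1] at h1; omega)
  have hPc' : u' < padD1 c → 2 * topPow (u' / 3) ≤ 2 ^ c := fun h1 =>
    two_mul_topPow_le (by rw [hD1] at h1; omega)
  set P := topPow (u / 3)
  set P' := topPow (u' / 3)
  rcases zSlotCol_spec c u' i' with ⟨hi0', hu0', e0'⟩ | ⟨hi0', hu0', e0'⟩ | ⟨hi0', hu0', e0'⟩ |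
      ⟨hi0', hu0', e0'⟩ | ⟨n0', n1', n2', n3', ⟨hu0', e0'⟩ | ⟨hu0', e0'⟩⟩ <;>
  rw [e0'] at h
  all_goals try have hA' : 2 * P' ≤ 2 ^ c := hPc' ‹u' < padD1 c›
  all_goals try have hA : 2 * P ≤ 2 ^ c := hPc ‹u < padD1 c›
  all_goals clear hPc hPc' e0'
  all_goals try simp only [not_and, not_lt] at n0' n1' n2' n3'
  all_goals omega

/-- Injectivity of the `z`-slot columns, case 6. [folklore] -/
theorem zSlotCol_inj_aux6 {c : ℕ} (hc : 2 ≤ c) {u u' i i' : ℕ} (hu : u < padD c) (hu' : u' < padD c)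
    (hi : i < 4) (hi' : i' < 4) (_n0 : i = 0 → padD1 c ≤ u) (_n1 : i = 1 → padD1 c ≤ u) (_n2 : i = 2 → 6 ≤ u) (_n3 : i = 3 → 6 ≤ u) (hu0 : padD1 c ≤ u)
    (h : padTall c + padD c * padE4 c + (2 * (padD1 c - 6) + 4 * (u - padD1 c) + i) = zSlotCol c u' i') : u = u' ∧ i = i' := by
  obtain ⟨h4, hD, hT, hD1, hDed, hE4⟩ := pad_sizes hc
  obtain ⟨hP1, hP2, hP3⟩ := topPow_bracket (u / 3)
  obtain ⟨hP1', hP2', hP3'⟩ := topPow_bracket (u' / 3)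
  have hdich := topPow_dichotomy (u / 3) (u' / 3)
  have hPc : u < padD1 c → 2 * topPow (u / 3) ≤ 2 ^ c := fun h1 =>
    two_mul_topPow_le (by rw [hD1] at h1; omega)
  have hPc' : u' < padD1 c → 2 * topPow (u' / 3) ≤ 2 ^ c := fun h1 =>
    two_mul_topPow_le (by rw [hD1] at h1; omega)
  set P := topPow (u / 3)
  set P' := topPow (u' / 3)
  rcases zSlotCol_spec c u' i' with ⟨hi0', hu0', e0'⟩ | ⟨hi0', hu0', e0'⟩ | ⟨hi0', hu0', e0'⟩ |
      ⟨hi0', hu0', e0'⟩ | ⟨n0', n1', n2', n3', ⟨hu0', e0'⟩ | ⟨hu0', e0'⟩⟩ <;>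
  rw [e0'] at h
  all_goals try have hA' : 2 * P' ≤ 2 ^ c := hPc' ‹u' < padD1 c›
  all_goals clear hPc hPc' e0'
  all_goals try simp only [not_and, not_lt] at n0' n1' n2' n3'
  all_goals omega

/-- The `z`-slot columns are injective in (label, slot). [folklore] -/
theorem zSlotCol_inj {c : ℕ} (hc : 2 ≤ c) {u u' i i' : ℕ} (hu : u < padD c) (hu' : u' < padD c)
    (hi : i < 4) (hi' : i' < 4) (h : zSlotCol c u i = zSlotCol c u' i') : u = u' ∧ i = i' := by
  rcases zSlotCol_spec c u i with ⟨hi0, hu0, e0⟩ | ⟨hi0, hu0, e0⟩ | ⟨hi0, hu0, e0⟩ | ⟨hi0, hu0, e0⟩ |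
      ⟨n0, n1, n2, n3, ⟨hu0, e0⟩ | ⟨hu0, e0⟩⟩ <;> rw [e0] at h
  · exact zSlotCol_inj_aux1 hc hu hu' hi hi' hi0 hu0 h
  · exact zSlotCol_inj_aux2 hc hu hu' hi hi' hi0 hu0 h
  · exact zSlotCol_inj_aux3 hc hu hu' hi hi' hi0 hu0 h
  · exact zSlotCol_inj_aux4 hc hu hu' hi hi' hi0 hu0 h
  · simp only [not_and, not_lt] at n0 n1 n2 n3
    exact zSlotCol_inj_aux5 hc hu hu' hi hi' n0 n1 n2 n3 hu0 h
  · simp only [not_and, not_lt] at n0 n1 n2 n3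
    exact zSlotCol_inj_aux6 hc hu hu' hi hi' n0 n1 n2 n3 hu0 h

/-- The `z`-slot columns avoid the main singleton pool. [folklore] -/
theorem zSlotCol_range {c : ℕ} (hc : 2 ≤ c) (u i : ℕ) :
    zSlotCol c u i < padTall c ∨ padTall c + padD c * padE4 c ≤ zSlotCol c u i := by
  obtain ⟨h4, hD, hT, hD1, hDed, hE4⟩ := pad_sizes hc
  obtain ⟨hP1, hP2, hP3⟩ := topPow_bracket (u / 3)
  have hPc : u < padD1 c → 2 * topPow (u / 3) ≤ 2 ^ c := fun h1 =>
    two_mul_topPow_le (by rw [hD1] at h1; omega)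
  unfold zSlotCol
  split_ifs with h0 h1
  · have := hPc h0.2; left; omega
  · have := hPc h1.2; left; omega
  · left; omega
  · left; omega
  · right; omega

/-- **The box map of the padded tableau is injective.** [folklore] -/
theorem padBox_injective {c : ℕ} (hc : 2 ≤ c) {u u' s s' : ℕ} (hu : u < padD c) (hu' : u' < padD c)
    (hs : s < 5 * c + 1) (hs' : s' < 5 * c + 1) (h : padBox c u s = padBox c u' s') :
    u = u' ∧ s = s' := by
  obtain ⟨h4, hD, hT, hD1, hDed, hE4⟩ := pad_sizes hc
  have h2c : 2 ^ (c + 1) = 2 * 2 ^ c := by rw [pow_succ]; ring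
  have hcol := congrArg Prod.fst h
  have hrow := congrArg Prod.snd h
  unfold padBox at hcol hrow
  by_cases h5 : s < 5 <;> by_cases h5' : s' < 5
  · -- gadget / gadget
    rw [if_pos h5] at hcol hrow; rw [if_pos h5'] at hcol hrow
    simp only at hcol hrow
    have hu3 : u + 3 < 3 * (2 ^ (c + 1) - 1) := by rw [h2c]; rw [hD] at hu; omega
    have hu3' : u' + 3 < 3 * (2 ^ (c + 1) - 1) := by rw [h2c]; rw [hD] at hu'; omega
    have hr := (boxColRow_snd_le (c := c) (by omega) u hu3 s h5).1
    have hr' := (boxColRow_snd_le (c := c) (by omega) u' hu3' s' h5').1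
    have hn := boxColRow_snd_ne (c := c) (by omega) u s hu3
    have hn' := boxColRow_snd_ne (c := c) (by omega) u' s' hu3'
    have hrow' : (boxColRow 1 (c + 1) (u + 3) s).2 = (boxColRow 1 (c + 1) (u' + 3) s').2 := by
      unfold padRow at hrow
      split_ifs at hrow <;> omega
    have key := boxColRow_injective 1 (c + 1) le_rfl (by omega)
      (u := ⟨u + 3, hu3⟩) (u' := ⟨u' + 3, hu3'⟩) (s := ⟨s, by omega⟩) (s' := ⟨s', by omega⟩)
      (Prod.ext hcol hrow')
    obtain ⟨k1, k2⟩ := key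
    have k1' := congrArg Fin.val k1
    have k2' := congrArg Fin.val k2
    simp only at k1' k2'
    exact ⟨by omega, by omega⟩
  · -- gadget / z : rows differ
    exfalso
    rw [if_pos h5] at hrow; rw [if_neg h5'] at hrow
    unfold padRow at hrow
    split_ifs at hrow
  · exfalso
    rw [if_neg h5] at hrow; rw [if_pos h5'] at hrow
    unfold padRow at hrow
    split_ifs at hrow
  · -- z / z
    rw [if_neg h5] at hcol; rw [if_neg h5'] at hcol
    by_cases h9 : s < 9 <;> by_cases h9' : s' < 9
    · rw [if_pos h9, if_pos h9'] at hcol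
      simp only at hcol
      have := zSlotCol_inj hc hu hu' (by omega) (by omega) hcol
      omega
    · exfalso
      rw [if_pos h9, if_neg h9'] at hcol
      simp only at hcol
      have hE : s' - 9 < padE4 c := by rw [hE4]; omega
      have h1 : u' * padE4 c + (s' - 9) < padD c * padE4 c := by
        have := Nat.mul_le_mul_right (padE4 c) (Nat.succ_le_of_lt hu')
        rw [Nat.succ_mul] at this; omega
      rcases zSlotCol_range hc u (s - 5) with hlt | hge <;> omega
    · exfalso
      rw [if_neg h9, if_pos h9'] at hcol
      simp only at hcol
      have hE : s - 9 < padE4 c := by rw [hE4]; omega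
      have h1 : u * padE4 c + (s - 9) < padD c * padE4 c := by
        have := Nat.mul_le_mul_right (padE4 c) (Nat.succ_le_of_lt hu)
        rw [Nat.succ_mul] at this; omega
      rcases zSlotCol_range hc u' (s' - 5) with hlt | hge <;> omega
    · rw [if_neg h9, if_neg h9'] at hcol
      simp only at hcol
      have hE : s - 9 < padE4 c := by rw [hE4]; omega
      have hE' : s' - 9 < padE4 c := by rw [hE4]; omega
      have hEpos : 0 < padE4 c := by omega
      have hq : (u * padE4 c + (s - 9)) / padE4 c = u := by
        rw [Nat.add_comm, Nat.add_mul_div_right _ _ hEpos, Nat.div_eq_of_lt hE, zero_add]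
      have hq' : (u' * padE4 c + (s' - 9)) / padE4 c = u' := by
        rw [Nat.add_comm, Nat.add_mul_div_right _ _ hEpos, Nat.div_eq_of_lt hE', zero_add]
      have heq : u * padE4 c + (s - 9) = u' * padE4 c + (s' - 9) := by omega
      have huu : u = u' := by rw [← hq, ← hq', heq]
      subst huu
      exact ⟨rfl, by omega⟩

/-! ## The frame -/

variable {σ : Type*}

/-- **The box map of the padded tableau is a bijection onto its diagram.** [folklore] -/
theorem paddedTab_box_bijective {c : ℕ} (hc : 2 ≤ c) (x : ℕ → σ) :
    Function.Bijective (fun p : Fin (paddedTab c hc x).d × Fin (paddedTab c hc x).m =>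
      (paddedTab c hc x).box p.1 p.2) := by
  classical
  rw [Fintype.bijective_iff_injective_and_card]
  constructor
  · rintro ⟨u, s⟩ ⟨u', s'⟩ h
    have h' := congrArg (fun b : (n : Fin (paddedTab c hc x).C) × Fin ((paddedTab c hc x).h n) =>
      (b.1.val, b.2.val)) h
    simp only [paddedTab, Prod.mk.eta] at h'
    obtain ⟨hu, hs⟩ := padBox_injective hc u.isLt u'.isLt s.isLt s'.isLt
      (Prod.ext (congrArg Prod.fst h') (congrArg Prod.snd h'))
    exact Prod.ext (Fin.ext hu) (Fin.ext hs)
  · rw [Fintype.card_prod, Fintype.card_fin, Fintype.card_fin, card_boxes_paddedTab hc x]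

/-- **The frame of the padded tableau.** [folklore] -/
def paddedTabFrame {c : ℕ} (hc : 2 ≤ c) (x : ℕ → σ) : (paddedTab c hc x).Frame where
  boxEquiv := Equiv.ofBijective _ (paddedTab_box_bijective hc x)
  box_eq _ _ := rfl

end

end Summit.ValiantsHypothesis.ValiantsHypothesis.Theorems.GeneratorObstructions.PerGenDegreeSuperQP
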